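import Summits.AnomalousDissipation.AnomalousDissipation.Theses.EnsembleRigidity
import Literature.Analysis.FunctionSpaces.TorusTrigPoly
import Literature.Analysis.FunctionSpaces.TorusCalculus

/-!
# Sketch — crux idea `pyritohedral-head-neck-body` for crux stmt-AnomalousDissipation-15509
(`EnsembleRigidity.GPMeanBoundedFamily`), ideator k = 1, round 1.

Work in the fixed space `Fix(G)` of the 24-element stabiliser `G` of the Galloway–Proctor force
`f_GP = (sin 2πx₂, sin 2πx₀, sin 2πx₁)` inside the affine hyperoctahedral group of `T³`
(`G = C₃ ⋉ {±1}³`, the sign pattern `ε` carrying the half-translation `b(ε)`; generators below).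
Computed facts (pure-python exact Fourier algebra, `compute/gp_symmetry.py`):
`dim Fix(G) ∩ E_m = 1, 1, 0, 0, 2, 2, –, 1, 3` for the shells `|k|² = m = 1 … 9` (m = 7 empty);
`Fix(G) ∩ E₁ = ℝ·f_GP`, `Fix(G) ∩ E₂ = ℝ·g` with `g = (f_GP·∇)f_GP / 2π` (the Lamb mode, already
solenoidal), so the symmetric Galerkin system on `|k|² ≤ 4` is the planar ODE
`ȧ = −4π²νa + |S| + γab`, `ḃ = −8π²νb − γa²`, `γ = 2π/√3`, whose unique equilibrium
`a ≈ 1.94 ν^{1/3}`, `b ≈ −0.174 ν^{-1/3}` is the census' quiet runaway arc in closed form.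

Contents: the transfer target `GPSymmetricMeanBoundedFamily` (the crux inside `Fix(G)`) with the
kernel-checked implication to the route decl; the first lemmas of the line as `Prop`s
(`FirstShellPinned`, `HeadPinned`, `LambIdentity`, `HeadCoefficients`, `SymmetricLerayHopfFromRest`).
-/

open scoped Real
open MeasureTheory Filter

noncomputable section

namespace Summit.AnomalousDissipation.AnomalousDissipation.Cruxes.GPMeanBoundedFamily.PyritohedralHeadNeckBody

open Literature.Analysis.FunctionSpaces Literature.Analysis.FluidPDE

local notation "𝕋³" => UnitAddTorus (Fin 3)
local notation "E³" => EuclideanSpace ℝ (Fin 3)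

/-- The pinned Galloway–Proctor force `f_GP`, byte-identical to the route decls' inline expression. -/
def gpForce : 𝕋³ → E³ := fun x : UnitAddTorus (Fin 3) =>
  (Literature.Analysis.FluidPDE.Torus.stokesMode (Pi.single (2 : Fin 3) (1 : ℤ)) (EuclideanSpace.single (0 : Fin 3) (1 : ℝ)) false x +
    Literature.Analysis.FluidPDE.Torus.stokesMode (Pi.single (0 : Fin 3) (1 : ℤ)) (EuclideanSpace.single (1 : Fin 3) (1 : ℝ)) false x +
    Literature.Analysis.FluidPDE.Torus.stokesMode (Pi.single (1 : Fin 3) (1 : ℤ)) (EuclideanSpace.single (2 : Fin 3) (1 : ℝ)) false x :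
    EuclideanSpace ℝ (Fin 3))

/-- The LAMB MODE `g = (f_GP·∇)f_GP/(2π) = (sin2πx₁ cos2πx₂, sin2πx₂ cos2πx₀, sin2πx₀ cos2πx₁)`:
solenoidal, on the shell `|k|² = 2`, `∫|g|² = 3/4`; it spans `Fix(G) ∩ E₂`. -/
def lambMode : 𝕋³ → E³ := fun x =>
  !₂[(fourier 1 (x 1) : ℂ).im * (fourier 1 (x 2) : ℂ).re,
     (fourier 1 (x 2) : ℂ).im * (fourier 1 (x 0) : ℂ).re,
     (fourier 1 (x 0) : ℂ).im * (fourier 1 (x 1) : ℂ).re]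

/-- The half period `½ ∈ ℝ/ℤ`. -/
def half : UnitAddCircle := ((1 / 2 : ℝ) : UnitAddCircle)

/-- Generator 1 of `G` (torus side): the coordinate 3-cycle `y ↦ (y₁, y₂, y₀)`. -/
def cyc (y : 𝕋³) : 𝕋³ := fun j => y (j + 1)

/-- Generator 3 of `G` (torus side): the twisted half-turn `y ↦ (y₀ + ½, −y₁, −y₂ + ½)`
(linear part `diag(1,−1,−1)`, translation `(½,0,½)`; generator 2 is the inversion `y ↦ −y`). -/
def twist (y : 𝕋³) : 𝕋³ := ![y 0 + half, -(y 1), -(y 2) + half]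

/-- `G`-SYMMETRY of a vector field (`u(Qy + b) = Q u(y)` for the three generators of the
stabiliser of `f_GP`): cyclic covariance, oddness under inversion (hence zero momentum and zero
helicity), covariance under the twisted half-turn. `f_GP` and `g` are `G`-symmetric; the ABC
halves `f_GP ± curl f_GP/2π` are not (the cosine partner is even). -/
def IsGPSymmetric (u : 𝕋³ → E³) : Prop :=
  (∀ (y : 𝕋³) (i : Fin 3), u (cyc y) i = u y (i + 1)) ∧
  (∀ (y : 𝕋³) (i : Fin 3), u (-y) i = -(u y i)) ∧
  (∀ y : 𝕋³, u (twist y) 0 = u y 0 ∧ u (twist y) 1 = -(u y 1) ∧ u (twist y) 2 = -(u y 2))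

/-- FIRST LEMMA (provable now, Fourier bookkeeping on the 12-dimensional first shell):
`Fix(G) ∩ E₁ = ℝ·f_GP` — a smooth solenoidal mean-zero FIRST-SHELL field that is `G`-symmetric is a
multiple of the force. Consequences: no Beltrami (ABC) direction, no shear laminate and no steady
Euler field of the first shell is available to a symmetric flow; the shell-1 amplitude of a
symmetric flow is ONE scalar `a = (u, f_GP)/‖f_GP‖`, and the work is `(f_GP, u) = ‖f_GP‖·a`. -/
def FirstShellPinned : Prop :=
  ∀ u : 𝕋³ → E³, Torus.IsSmooth u → Torus.IsDivFree u → Torus.HasZeroMean u →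
    Torus.fourierTruncate 1 u = u → IsGPSymmetric u → ∃ c : ℝ, u = c • gpForce

/-- SECOND LEMMA (provable now, same bookkeeping on `|k|² ≤ 4`, 64 real dimensions):
`Fix(G) ∩ (E₁ ⊕ E₂ ⊕ E₃ ⊕ E₄) = ℝ·f_GP ⊕ ℝ·g` — the symmetric Galerkin space of level 2 is the
HEAD plane; shells 3 and 4 carry no symmetric field at all. -/
def HeadPinned : Prop :=
  ∀ u : 𝕋³ → E³, Torus.IsSmooth u → Torus.IsDivFree u → Torus.HasZeroMean u →
    Torus.fourierTruncate 2 u = u → IsGPSymmetric u → ∃ c₁ c₂ : ℝ, u = c₁ • gpForce + c₂ • lambMode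

/-- THIRD LEMMA (provable now, calculus): the Lamb vector of the force is `2π g` pointwise (it is
already divergence free, so no Leray projection is needed). -/
def LambIdentity : Prop :=
  ∀ x : 𝕋³, Torus.convect gpForce gpForce x = (2 * π) • lambMode x

/-- FOURTH LEMMA (provable now, trigonometric integrals): the HEAD COEFFICIENTS. With
`γ := 2π/√3 = (P B(Ŝ,Ŝ), ĝ)` for the unit vectors `Ŝ = f_GP/‖f_GP‖`, `ĝ = g/‖g‖`
(`‖f_GP‖² = 3/2`, `‖g‖² = 3/4`): `∫⟪(f·∇)f, g⟫ = 2π·(3/4)`, while `g` does not feed back on the head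
through its own Lamb vector and the cross terms do not self-interact on `g`:
`∫⟪(g·∇)g, f⟫ = ∫⟪(g·∇)g, g⟫ = ∫⟪(f·∇)g + (g·∇)f, g⟫ = 0`. Hence the symmetric Galerkin system of
level 2 is `ȧ = −4π²νa + ‖f‖ + γab`, `ḃ = −8π²νb − γa²`. -/
def HeadCoefficients : Prop :=
  (∫ x : 𝕋³, inner ℝ (Torus.convect gpForce gpForce x) (lambMode x) = 2 * π * (3 / 4)) ∧
  (∫ x : 𝕋³, inner ℝ (Torus.convect lambMode lambMode x) (gpForce x) = 0) ∧
  (∫ x : 𝕋³, inner ℝ (Torus.convect lambMode lambMode x) (lambMode x) = 0) ∧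
  (∫ x : 𝕋³, inner ℝ (Torus.convect gpForce lambMode x + Torus.convect lambMode gpForce x) (lambMode x) = 0) ∧
  (∫ x : 𝕋³, ‖gpForce x‖ ^ 2 = 3 / 2) ∧ (∫ x : 𝕋³, ‖lambMode x‖ ^ 2 = 3 / 4)

/-- SUPPORT (routine, pattern of `Theorems/TaylorCertificatesZeroDatumLerayHopf`): symmetric global
Leray–Hopf solutions with `H`-valued lifts exist from rest at every viscosity (Galerkin inside the
closed invariant subspace `Fix(G)`; weak limits stay there). -/
def SymmetricLerayHopfFromRest : Prop :=
  ∀ ν : ℝ, 0 < ν →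
    ∃ (u : ℝ → 𝕋³ → E³) (U : ℝ → Torus.energySpace (Fin 3)),
      Torus.IsGlobalLerayHopf ν (fun _ => gpForce) 0 u ∧
      (∀ t, 0 ≤ t → ((U t : Lp E³ 2 (volume : Measure 𝕋³)) : 𝕋³ → E³) =ᵐ[volume] u t) ∧
      ∀ t, 0 ≤ t → IsGPSymmetric (u t)

/-- TRANSFER TARGET `C⁺` (the crux inside `Fix(G)`): a mean-bounded family of `G`-SYMMETRIC
zero-momentum Leray–Hopf solutions of `NS_ν(f_GP)` along `ν_j → 0`. Trivially stronger than the
crux; easier because in `Fix(G)` the only runaway channel is the explicit head–neck chain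
`f → g → {|k|² = 5, 6}` (no Beltrami, laminate or first/second-shell Euler skeleton exists). -/
def GPSymmetricMeanBoundedFamily : Prop :=
  ∀ f : UnitAddTorus (Fin 3) → EuclideanSpace ℝ (Fin 3), f = gpForce →
    ∃ (E : ℝ) (ν : ℕ → ℝ) (u₀ : ℕ → UnitAddTorus (Fin 3) → EuclideanSpace ℝ (Fin 3))
      (u : ℕ → ℝ → UnitAddTorus (Fin 3) → EuclideanSpace ℝ (Fin 3))
      (U : ℕ → ℝ → Literature.Analysis.FunctionSpaces.Torus.energySpace (Fin 3)),
      (∀ j, 0 < ν j ∧ ν j ≤ 1) ∧ Filter.Tendsto ν Filter.atTop (nhds 0) ∧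
      (∀ j, Literature.Analysis.FluidPDE.Torus.IsGlobalLerayHopf (ν j) (fun _ => f) (u₀ j) (u j)) ∧
      (∀ j t, 0 ≤ t → ((U j t : MeasureTheory.Lp (EuclideanSpace ℝ (Fin 3)) 2
          (MeasureTheory.volume : MeasureTheory.Measure (UnitAddTorus (Fin 3)))) :
            UnitAddTorus (Fin 3) → EuclideanSpace ℝ (Fin 3)) =ᵐ[MeasureTheory.volume] u j t) ∧
      (∀ j t, 0 ≤ t → IsGPSymmetric (u j t)) ∧
      ∀ j, Literature.Analysis.FluidPDE.meanEnergy (u j) ≤ E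

/-- `C⁺ → crux` (kernel-checked): forget the symmetry clause. -/
theorem gpMeanBoundedFamily_of_symmetric (h : GPSymmetricMeanBoundedFamily) :
    Summit.AnomalousDissipation.AnomalousDissipation.Theses.EnsembleRigidity.GPMeanBoundedFamily := by
  intro f hf
  obtain ⟨E, ν, u₀, u, U, hν, hν0, hLH, hU, -, hE⟩ := h f (hf.trans rfl)
  exact ⟨E, ν, u₀, u, U, hν, hν0, hLH, hU, hE⟩

end Summit.AnomalousDissipation.AnomalousDissipation.Cruxes.GPMeanBoundedFamily.PyritohedralHeadNeckBody

end
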